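import Summits.HodgeConjecture.HodgeConjecture.Theorems.Ring2WeilCoverageCMFieldAllPrimesG
import Summits.HodgeConjecture.HodgeConjecture.Theorems.Ring2WeilCoverageCMFieldAllPrimesI
import Mathlib.FieldTheory.Finite.Basic
import Mathlib.Algebra.CharP.Lemmas
import HarnessLib

/-!
# Weil-type components over quartic CM fields, IX (part K): the SPLIT side of `ℚ(√-(2+√2))` for a variable prime
# `ℓ ≡ 1, 7 (mod 16)` — degree-one places (`ζ₁₆`, Frobenius in `𝔽_ℓ(√-2)`) and the norm form of `ℤ[ζ₁₆ - ζ₁₆⁻¹]`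

research route conditional on HC_CM; not a corollary; Q11.4-sentence-2 already refuted in dim ≥ 3. Cell
`pub-hodge-ring2`, seat `ring2-b03` (gen 52). After parts A–J exactly one congruence class of the six Galois census
tables is undecided for a VARIABLE prime: the SPLIT side `ℓ ≡ 1, 7 (mod 16)` of the cyclic quartic field
`E = ℚ(√-(2+√2)) = ℚ(ζ₁₆ - ζ₁₆⁻¹) ⊂ ℚ(ζ₁₆)` (`F = ℚ(√2)`, Deligne's `R = S² + 4S + 2`, `σ = η²`, `ρ := σ + 2 = ±√2`),
known so far by the numerals `[2] = [7] = [17] = [23] = [1]` only (gen 49). This part and part L prove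
**`[ℓ] = [1]` for EVERY prime `ℓ ≡ 1, 7 (mod 16)`** — the `ζ₁₆`-analogue of parts I/J (`ζ₅`) — hence the complete
classification `[ℓ] ≠ [1] ⟺ ℓ ≢ ±1 (mod 16), ℓ ≠ 2` for the sixth field. Here (all in the kernel, no named fact):

0. (§0, PLACES) a root `e` of `T⁴ + 4T² + 2` (the minimal polynomial of `η = ζ₁₆ - ζ₁₆⁻¹`) in `𝔽_ℓ`: for
   `ℓ ≡ 1 (mod 16)`, `e = ζ + ζ⁷` with `ζ⁸ = -1` (`ζ = a^{(ℓ-1)/16}`, `a` a non-square, Euler's criterion); for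
   `ℓ ≡ 7 (mod 16)`, `e² = √2 - 2` IS solvable in `𝔽_ℓ`: otherwise `√2 - 2 = -2y²` (`-2` and `√2 - 2` both non-squares),
   and in `K = 𝔽_ℓ[S]/(S² + 2)` the element `x = sy` has `x² = √2 - 2`, so part G's `z = (x² + s)/(2x)` has `z⁸ = -1`,
   while FROBENIUS (`s^ℓ = -s`, `x^ℓ = -x`) gives `z^{ℓ+1} = -z·z̄' = 1` against `z^{ℓ+1} = z^{16j+8} = -1`;
1. (§1, NORM FORM) for `z = (c₀ + c₁ρ) + (c₂ + c₃ρ)η ∈ ℤ[η] = 𝓞_E`: `Q(c) := Nm_{E/ℚ}(z)` is DIVISIBLE by `ℓ` when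
   `z ↦ 0` at the place `η ↦ e`, `ρ ↦ e² + 2` (explicit identity `Q = z·M + N·(e⁴ + 4e² + 2)`), is the SUM OF SQUARES
   `Q = P₀² + 2(P₁² + P₂² + P₃²)` (`P₀ = c₀² - 2c₁² = Nm(c₀ + c₁ρ)`, `P₁ = c₀c₂ - 2c₀c₃ + 2c₁c₂ - 2c₁c₃`,
   `P₂ = c₀c₂ - 2c₁c₃`, `P₃ = c₂² - 2c₃² = Nm(c₂ + c₃ρ)` — the Lagrange identity for
   `Nm_{F/ℚ}(4(a² - σb²)) = Nm_{F/ℚ}((2a)² + (σb)² + (ρb)²)`, `-4σ = σ² + 2`), vanishes only at `c = 0` (`√2 ∉ ℚ`),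
   and is `≤ 128·m⁴` on the box `|cᵢ| ≤ m`.

Part L: the Thue box (part I `box_four` with `f = e² + 2`), the norm witness `z·τz` (`τ : η ↦ (3+σ)η`, `σ ↦ -4-σ`),
the numerals `71, 97, 103, 113`, the peeling, the main theorem and the complete classification.
No named fact, no definition, no `sorry`; nothing about the Hodge conjecture is asserted.
References: [Deligne1982HodgeCycles] §4 p. 30 (1), Cor. 4.2, Lemma 4.6; [Landherr1936HermitianForms]. -/

noncomputable section

set_option linter.dupNamespace false

open Polynomial

namespace Summit.HodgeConjecture.HodgeConjecture.Ring2.WeilCoverageCM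

open Literature.AlgebraicGeometry.Deligne1982
open Literature.AlgebraicGeometry.HodgeTheory (splitDiscriminantClassCM)

/-! ### §0 Degree-one places of `E = ℚ(√-(2+√2))` over `ℓ ≡ 1, 7 (mod 16)` -/

section Places

/-- The algebra of `η = ζ₁₆ - ζ₁₆⁻¹ = ζ₁₆ + ζ₁₆⁷`: if `ζ⁸ = -1` then `e = ζ + ζ⁷` is a root of `T⁴ + 4T² + 2`
(`e² + 2 = ζ² - ζ⁶ = √2`). [folklore] -/
theorem quartic_eq_zero_of_pow_eight_eq_neg_one {K : Type*} [CommRing K] (ζ : K) (hζ : ζ ^ 8 = -1) :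
    (ζ + ζ ^ 7) ^ 4 + 4 * (ζ + ζ ^ 7) ^ 2 + 2 = 0 := by
  linear_combination (ζ ^ 20 + 4 * ζ ^ 14 - ζ ^ 12 + 6 * ζ ^ 8 + ζ ^ 4 + 4 * ζ ^ 2 + 2) * hζ

variable {ℓ : ℕ} [hℓ : Fact ℓ.Prime]

/-- **A primitive 16th root of unity in `𝔽_ℓ`, `ℓ ≡ 1 (mod 16)`**: `ζ = a^{(ℓ-1)/16}` for a non-square `a` has
`ζ⁸ = a^{(ℓ-1)/2} = -1` (Euler's criterion). [folklore] -/
theorem exists_pow_eight_eq_neg_one_of_mod_sixteen_one (h16 : ℓ % 16 = 1) : ∃ ζ : ZMod ℓ, ζ ^ 8 = -1 := by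
  have hchar : ringChar (ZMod ℓ) ≠ 2 := by rw [ZMod.ringChar_zmod_n]; omega
  obtain ⟨a, ha⟩ := FiniteField.exists_nonsquare hchar
  have ha0 : a ≠ 0 := by
    rintro rfl
    exact ha ⟨0, (mul_zero _).symm⟩
  have heul : a ^ (ℓ / 2) = -1 :=
    (ZMod.pow_div_two_eq_neg_one_or_one ℓ ha0).resolve_left (fun h => ha ((ZMod.euler_criterion ℓ ha0).2 h))
  refine ⟨a ^ (ℓ / 16), ?_⟩
  rw [← pow_mul, show ℓ / 16 * 8 = ℓ / 2 by omega, heul]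

/-- **A root of `T⁴ + 4T² + 2` in `𝔽_ℓ` for `ℓ ≡ 1 (mod 16)`** (`e = ζ + ζ⁷`, `ζ⁸ = -1`): a
degree-one place of `E = ℚ(√-(2+√2))` over `ℓ`. [folklore] -/
theorem exists_root_quartic_of_mod_sixteen_one (h16 : ℓ % 16 = 1) :
    ∃ e : ZMod ℓ, e ^ 4 + 4 * e ^ 2 + 2 = 0 := by
  obtain ⟨ζ, hζ⟩ := exists_pow_eight_eq_neg_one_of_mod_sixteen_one (ℓ := ℓ) h16
  exact ⟨ζ + ζ ^ 7, quartic_eq_zero_of_pow_eight_eq_neg_one ζ hζ⟩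

/-- **`x² = √2 - 2` IS solvable in `𝔽_ℓ` for a prime `ℓ ≡ 7 (mod 16)`** (`r² = 2`; the companion of part G's
`no_sq_eq_sqrt_two_sub_two_of_mod_sixteen`, `ℓ ≡ 15 (mod 16)`). If not, `r - 2` and `-2` are non-squares
(`ℓ ≡ 7 (mod 8)`), so `r - 2 = -2y²` (Euler's criterion), and in the field `K = 𝔽_ℓ[S]/(S² + 2)` the element `x = sy`
satisfies `x² = r - 2`, `x ≠ 0`; part G's `z = (x² + s)/(2x)` has `z⁸ = -1` and `z·(x² - s)/(2x) = -1`; Frobenius gives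
`s^ℓ = -s`, `y^ℓ = y`, so `x^ℓ = -x` and `z^ℓ = -(x² - s)/(2x)`, whence `z^{ℓ+1} = 1`; but `ℓ + 1 = 16j + 8` and
`z¹⁶ = 1` give `z^{ℓ+1} = z⁸ = -1` — so `1 = -1` in `K`, absurd. (In `ℚ(ζ₁₆)`: a prime `ℓ ≡ 7 (mod 16)` is totally
split in `E = ℚ(ζ₁₆ - ζ₁₆⁻¹)`, the fixed field of `{1, 7} ⊂ (ℤ/16)^×`.) [folklore] -/
theorem isSquare_sqrt_two_sub_two_of_mod_sixteen_seven (h16 : ℓ % 16 = 7) (r : ZMod ℓ) (hr : r ^ 2 = 2) :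
    IsSquare (r - 2) := by
  have h2 : ℓ ≠ 2 := by omega
  have h2' : (2 : ZMod ℓ) ≠ 0 := by exact_mod_cast natCast_prime_ne_zero_zmod Nat.prime_two h2
  by_contra hns'
  have hns : ¬ IsSquare (-2 : ZMod ℓ) := by rw [ZMod.exists_sq_eq_neg_two_iff h2]; omega
  have ht0 : r - 2 ≠ 0 := by
    intro h
    have hr2 : r = 2 := by linear_combination h
    rw [hr2] at hr
    exact h2' (by linear_combination hr)
  have hm2 : (-2 : ZMod ℓ) ≠ 0 := neg_ne_zero.2 h2'
  have heul1 : (r - 2) ^ (ℓ / 2) = -1 :=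
    (ZMod.pow_div_two_eq_neg_one_or_one ℓ ht0).resolve_left (fun h => hns' ((ZMod.euler_criterion ℓ ht0).2 h))
  have heul2 : (-2 : ZMod ℓ) ^ (ℓ / 2) = -1 :=
    (ZMod.pow_div_two_eq_neg_one_or_one ℓ hm2).resolve_left (fun h => hns ((ZMod.euler_criterion ℓ hm2).2 h))
  -- `c = (r - 2)·(-2)^{ℓ-2} = (r - 2)/(-2)` is a square `y²`
  obtain ⟨c, hc⟩ : ∃ c : ZMod ℓ, c = (r - 2) * (-2) ^ (ℓ - 2) := ⟨_, rfl⟩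
  have hc0 : c ≠ 0 := by rw [hc]; exact mul_ne_zero ht0 (pow_ne_zero _ hm2)
  have hcsq : IsSquare c := by
    rw [ZMod.euler_criterion ℓ hc0, hc, mul_pow, ← pow_mul, mul_comm (ℓ - 2) (ℓ / 2), pow_mul, heul1, heul2]
    have hodd : ℓ - 2 = 2 * ((ℓ - 3) / 2) + 1 := by omega
    rw [hodd, pow_succ, pow_mul]
    norm_num
  obtain ⟨y, hy⟩ := hcsq
  have hy0 : y ≠ 0 := by
    rintro rfl
    rw [mul_zero] at hy
    exact hc0 hy
  have hfermat : (-2 : ZMod ℓ) ^ (ℓ - 1) = 1 := ZMod.pow_card_sub_one_eq_one hm2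
  have hy2 : -2 * y ^ 2 = r - 2 := by
    rw [sq, ← hy, hc]
    rw [show ℓ - 1 = (ℓ - 2) + 1 by omega, pow_succ] at hfermat
    linear_combination (r - 2) * hfermat
  -- the field `K = 𝔽_ℓ[S]/(S² + a)`, `a = 2` opaque (no numeral in the type)
  obtain ⟨a, ha⟩ : ∃ a : ZMod ℓ, a = 2 := ⟨2, rfl⟩
  have hmonic : (X ^ 2 + C a).Monic := by monicity!
  have hdeg : (X ^ 2 + C a).natDegree = 2 := by compute_degree!
  have hirr : Irreducible (X ^ 2 + C a) := by
    rw [hmonic.irreducible_iff_roots_eq_zero_of_degree_le_three (by rw [hdeg]) (by rw [hdeg]; norm_num),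
      Multiset.eq_zero_iff_forall_notMem]
    intro t ht
    rw [mem_roots hmonic.ne_zero, IsRoot, eval_add, eval_pow, eval_X, eval_C] at ht
    have ht' : t ^ 2 + 2 = 0 := by rw [← ha]; exact ht
    exact hns ⟨t, by linear_combination -ht'⟩
  haveI : Fact (Irreducible (X ^ 2 + C a)) := ⟨hirr⟩
  haveI : CharP (AdjoinRoot (X ^ 2 + C a)) ℓ :=
    charP_of_injective_algebraMap (algebraMap (ZMod ℓ) (AdjoinRoot (X ^ 2 + C a))).injective ℓ
  set ι := AdjoinRoot.of (X ^ 2 + C a) with hι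
  set s := AdjoinRoot.root (X ^ 2 + C a) with hsdef
  have hιa : ι a = 2 := (congrArg ι ha).trans (map_ofNat ι 2)
  have hs : s ^ 2 = -2 := by
    have h := AdjoinRoot.eval₂_root (X ^ 2 + C a)
    rw [eval₂_add, eval₂_X_pow, eval₂_C] at h
    rw [← hιa]
    linear_combination h
  have h2K : (2 : AdjoinRoot (X ^ 2 + C a)) ≠ 0 := by
    intro h
    apply h2'
    apply ι.injective
    rw [map_zero, ← h]
    exact map_ofNat ι 2
  have hs0 : s ≠ 0 := by
    intro h
    rw [h] at hs
    apply h2K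
    linear_combination hs
  have hrK : (ι r) ^ 2 = 2 := by rw [← map_pow, hr]; exact map_ofNat ι 2
  -- `x = s·y`: `x² = -2y² = r - 2`
  set x : AdjoinRoot (X ^ 2 + C a) := s * ι y with hxdef
  have hxK : x ^ 2 = ι r - 2 := by
    have h := congrArg ι hy2
    rw [map_mul, map_neg, map_pow, map_sub, map_ofNat] at h
    rw [hxdef, mul_pow, hs, ← h]
  have hxK0 : x ≠ 0 := mul_ne_zero hs0 ((map_ne_zero_iff ι ι.injective).2 hy0)
  obtain ⟨hz8, hzz⟩ := pow_eight_eq_neg_one_of_sqrt_data h2K (ι r) s x hrK hs hxK hxK0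
  set z := (x ^ 2 + s) / (2 * x) with hz
  -- Frobenius: `s^ℓ = -s`, `(ι t)^ℓ = ι t`, `x^ℓ = -x`
  have hodd : ℓ = 2 * (ℓ / 2) + 1 := by omega
  have hneg2 : (-2 : AdjoinRoot (X ^ 2 + C a)) = ι (-2) := by
    rw [map_neg]; exact congrArg Neg.neg (map_ofNat ι 2).symm
  have hsℓ : s ^ ℓ = -s := by
    have h1 : (s ^ 2) ^ (ℓ / 2) * s = s ^ ℓ := by rw [← pow_mul, ← pow_succ, ← hodd]
    rw [← h1, hs, hneg2, ← map_pow, heul2, map_neg, map_one]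
    ring
  have hfix : ∀ t : ZMod ℓ, (ι t) ^ ℓ = ι t := fun t => by rw [← map_pow, ZMod.pow_card]
  have h2ℓ : (2 : AdjoinRoot (X ^ 2 + C a)) ^ ℓ = 2 := by
    have h := hfix 2
    have e : ι 2 = 2 := map_ofNat ι 2
    rw [e] at h
    exact h
  have hxℓ : x ^ ℓ = -x := by rw [hxdef, mul_pow, hsℓ, hfix]; ring
  -- make `x` opaque, so that `mul_pow` below only sees `(2 * x) ^ ℓ`
  clear_value x
  have hzℓ : z ^ ℓ = -((x ^ 2 - s) / (2 * x)) := by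
    rw [hz, div_pow, add_pow_char, mul_pow, ← pow_mul, mul_comm 2 ℓ, pow_mul, hxℓ, hsℓ, h2ℓ, neg_sq, mul_neg,
      div_neg, sub_eq_add_neg]
  -- `z^{ℓ+1} = 1` and `= -1`
  have hone : z ^ (ℓ + 1) = 1 := by
    rw [pow_succ' z ℓ, hzℓ, mul_neg, hzz, neg_neg]
  have hneg : z ^ (ℓ + 1) = -1 := by
    obtain ⟨j, hj⟩ : ∃ j, ℓ + 1 = 16 * j + 8 := ⟨ℓ / 16, by omega⟩
    have h16z : z ^ 16 = 1 := by
      rw [show (16 : ℕ) = 8 * 2 by norm_num, pow_mul z 8 2, hz8]; norm_num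
    rw [hj, pow_add z (16 * j) 8, pow_mul z 16 j, h16z, one_pow, one_mul, hz8]
  have hcontra : (1 : AdjoinRoot (X ^ 2 + C a)) = -1 := hone.symm.trans hneg
  exact h2K (by linear_combination hcontra)

/-- **A root of `T⁴ + 4T² + 2` in `𝔽_ℓ` for `ℓ ≡ 7 (mod 16)`**: `e² = r - 2`, `r² = 2`
(`isSquare_sqrt_two_sub_two_of_mod_sixteen_seven`), and `e⁴ + 4e² + 2 = (e² + 2)² - 2 = r² - 2 = 0`. [folklore] -/
theorem exists_root_quartic_of_mod_sixteen_seven (h16 : ℓ % 16 = 7) :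
    ∃ e : ZMod ℓ, e ^ 4 + 4 * e ^ 2 + 2 = 0 := by
  have h2 : ℓ ≠ 2 := by omega
  obtain ⟨r, hr⟩ := (ZMod.exists_sq_eq_two_iff h2).2 (Or.inr (by omega))
  have hr' : r ^ 2 = 2 := by rw [sq, ← hr]
  obtain ⟨e, he⟩ := isSquare_sqrt_two_sub_two_of_mod_sixteen_seven (ℓ := ℓ) h16 r hr'
  refine ⟨e, ?_⟩
  have he' : e ^ 2 = r - 2 := by rw [sq, ← he]
  linear_combination (e ^ 2 + r + 2) * he' + hr'

/-- **A degree-one place of `E = ℚ(√-(2+√2))` over every prime `ℓ ≡ 1, 7 (mod 16)`**: a root of the minimal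
polynomial `T⁴ + 4T² + 2` of `η = ζ₁₆ - ζ₁₆⁻¹` in `𝔽_ℓ`. [folklore] -/
theorem exists_root_cmPoly_sqrtNegTwoPlusSqrtTwo (h16 : ℓ % 16 = 1 ∨ ℓ % 16 = 7) :
    ∃ e : ZMod ℓ, e ^ 4 + 4 * e ^ 2 + 2 = 0 := by
  rcases h16 with h | h
  · exact exists_root_quartic_of_mod_sixteen_one (ℓ := ℓ) h
  · exact exists_root_quartic_of_mod_sixteen_seven (ℓ := ℓ) h

end Places

/-! ### §1 The norm form of `ℚ(√-(2+√2))` on `z = (c₀ + c₁ρ) + (c₂ + c₃ρ)η`: divisibility, sum of squares,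
bound, nonvanishing -/

section NormForm

/-- **Divisibility identity** in any commutative ring: if `e⁴ + 4e² + 2 = 0` (`η ↦ e`, `σ ↦ e²`, `ρ ↦ e² + 2`) and
`z = (c₀ + c₁ρ) + (c₂ + c₃ρ)η ↦ 0`, then `Nm_{E/ℚ}(z) = P₀² + 2(P₁² + P₂² + P₃²) ↦ 0` — by the explicit identity
`Nm(z) = z·M + N·(e⁴ + 4e² + 2)` (`M` = the product of the three other conjugates of `z` reduced mod `e⁴ + 4e² + 2`:
the conjugates of `η` are `±η`, `±(3+σ)η`). [folklore] -/
theorem sqrtNegTwoPlusSqrtTwo_normForm_eq_zero_of_root {K : Type*} [CommRing K] (e c₀ c₁ c₂ c₃ : K)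
    (he : e ^ 4 + 4 * e ^ 2 + 2 = 0) (hL : c₀ + c₁ * (e ^ 2 + 2) + (c₂ + c₃ * (e ^ 2 + 2)) * e = 0) :
    (c₀ ^ 2 - 2 * c₁ ^ 2) ^ 2 + 2 * ((c₀ * c₂ - 2 * c₀ * c₃ + 2 * c₁ * c₂ - 2 * c₁ * c₃) ^ 2
      + (c₀ * c₂ - 2 * c₁ * c₃) ^ 2 + (c₂ ^ 2 - 2 * c₃ ^ 2) ^ 2) = 0 := by
  linear_combination
    (c₀ ^ 3 - c₀ ^ 2 * c₁ * e ^ 2 - 2 * c₀ ^ 2 * c₁ - c₀ ^ 2 * c₂ * e - c₀ ^ 2 * c₃ * e ^ 3 - 2 * c₀ ^ 2 * c₃ * e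
      - 2 * c₀ * c₁ ^ 2 + 2 * c₀ * c₁ * c₂ * e ^ 3 + 4 * c₀ * c₁ * c₂ * e + 4 * c₀ * c₁ * c₃ * e + c₀ * c₂ ^ 2 * e ^ 2
      + 4 * c₀ * c₂ ^ 2 - 4 * c₀ * c₂ * c₃ * e ^ 2 - 12 * c₀ * c₂ * c₃ + 2 * c₀ * c₃ ^ 2 * e ^ 2 + 8 * c₀ * c₃ ^ 2
      + 2 * c₁ ^ 3 * e ^ 2 + 4 * c₁ ^ 3 - 2 * c₁ ^ 2 * c₂ * e - 2 * c₁ ^ 2 * c₃ * e ^ 3 - 4 * c₁ ^ 2 * c₃ * e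
      + 2 * c₁ * c₂ ^ 2 * e ^ 2 + 6 * c₁ * c₂ ^ 2 - 4 * c₁ * c₂ * c₃ * e ^ 2 - 16 * c₁ * c₂ * c₃ + 4 * c₁ * c₃ ^ 2 * e ^ 2
      + 12 * c₁ * c₃ ^ 2 - c₂ ^ 3 * e ^ 3 - 4 * c₂ ^ 3 * e + 2 * c₂ ^ 2 * c₃ * e ^ 3 + 6 * c₂ ^ 2 * c₃ * e
      + 2 * c₂ * c₃ ^ 2 * e ^ 3 + 8 * c₂ * c₃ ^ 2 * e - 4 * c₃ ^ 3 * e ^ 3 - 12 * c₃ ^ 3 * e) * hL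
    + (c₀ ^ 2 * c₁ ^ 2 + 2 * c₀ ^ 2 * c₁ * c₃ * e + 2 * c₀ ^ 2 * c₂ * c₃ + c₀ ^ 2 * c₃ ^ 2 * e ^ 2
      - 2 * c₀ * c₁ ^ 2 * c₂ * e - 3 * c₀ * c₁ * c₂ ^ 2 - 2 * c₀ * c₁ * c₂ * c₃ * e ^ 2 + 4 * c₀ * c₁ * c₂ * c₃
      - 6 * c₀ * c₁ * c₃ ^ 2 - c₀ * c₂ ^ 2 * c₃ * e + 4 * c₀ * c₂ * c₃ ^ 2 * e - 2 * c₀ * c₃ ^ 3 * e - 2 * c₁ ^ 4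
      - 2 * c₁ ^ 2 * c₂ ^ 2 + 8 * c₁ ^ 2 * c₂ * c₃ + 2 * c₁ ^ 2 * c₃ ^ 2 * e ^ 2 - 4 * c₁ ^ 2 * c₃ ^ 2 + c₁ * c₂ ^ 3 * e
      - 4 * c₁ * c₂ ^ 2 * c₃ * e + 2 * c₁ * c₂ * c₃ ^ 2 * e + c₂ ^ 4 + c₂ ^ 3 * c₃ * e ^ 2 - 2 * c₂ ^ 2 * c₃ ^ 2 * e ^ 2
      - 4 * c₂ ^ 2 * c₃ ^ 2 - 2 * c₂ * c₃ ^ 3 * e ^ 2 + 4 * c₃ ^ 4 * e ^ 2 + 4 * c₃ ^ 4) * he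

/-- **Divisibility.** At a degree-one place `η ↦ e` of `E = ℚ(√-(2+√2))` over `ℓ` (`e⁴ + 4e² + 2 = 0` in `𝔽_ℓ`),
if `z = (c₀ + c₁ρ) + (c₂ + c₃ρ)η ↦ 0` then `ℓ ∣ Nm_{E/ℚ}(z) = P₀² + 2(P₁² + P₂² + P₃²)`. [folklore] -/
theorem sqrtNegTwoPlusSqrtTwo_normForm_zmod_eq_zero {ℓ : ℕ} (e : ZMod ℓ) (he : e ^ 4 + 4 * e ^ 2 + 2 = 0)
    (c₀ c₁ c₂ c₃ : ℤ) (hL : (c₀ : ZMod ℓ) + c₁ * (e ^ 2 + 2) + (c₂ + c₃ * (e ^ 2 + 2)) * e = 0) :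
    ((((c₀ ^ 2 - 2 * c₁ ^ 2) ^ 2 + 2 * ((c₀ * c₂ - 2 * c₀ * c₃ + 2 * c₁ * c₂ - 2 * c₁ * c₃) ^ 2
      + (c₀ * c₂ - 2 * c₁ * c₃) ^ 2 + (c₂ ^ 2 - 2 * c₃ ^ 2) ^ 2) : ℤ)) : ZMod ℓ) = 0 := by
  push_cast
  linear_combination sqrtNegTwoPlusSqrtTwo_normForm_eq_zero_of_root e (c₀ : ZMod ℓ) c₁ c₂ c₃ he hL

/-- **Bound.** `|cᵢ| ≤ m ⇒ P₀² + 2(P₁² + P₂² + P₃²) ≤ 128·m⁴` (`|P₀|, |P₃| ≤ 2m²`, `|P₁| ≤ 7m²`, `|P₂| ≤ 3m²`).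
[folklore] -/
theorem sqrtNegTwoPlusSqrtTwo_normForm_le (m : ℕ) (c₀ c₁ c₂ c₃ : ℤ) (h₀ : |c₀| ≤ m) (h₁ : |c₁| ≤ m) (h₂ : |c₂| ≤ m)
    (h₃ : |c₃| ≤ m) :
    (c₀ ^ 2 - 2 * c₁ ^ 2) ^ 2 + 2 * ((c₀ * c₂ - 2 * c₀ * c₃ + 2 * c₁ * c₂ - 2 * c₁ * c₃) ^ 2
      + (c₀ * c₂ - 2 * c₁ * c₃) ^ 2 + (c₂ ^ 2 - 2 * c₃ ^ 2) ^ 2) ≤ 128 * (m : ℤ) ^ 4 := by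
  obtain ⟨h₀l, h₀r⟩ := abs_le.1 h₀
  obtain ⟨h₁l, h₁r⟩ := abs_le.1 h₁
  obtain ⟨h₂l, h₂r⟩ := abs_le.1 h₂
  obtain ⟨h₃l, h₃r⟩ := abs_le.1 h₃
  have s₀ : c₀ ^ 2 ≤ (m : ℤ) ^ 2 := sq_le_sq' h₀l h₀r
  have s₁ : c₁ ^ 2 ≤ (m : ℤ) ^ 2 := sq_le_sq' h₁l h₁r
  have s₂ : c₂ ^ 2 ≤ (m : ℤ) ^ 2 := sq_le_sq' h₂l h₂r
  have s₃ : c₃ ^ 2 ≤ (m : ℤ) ^ 2 := sq_le_sq' h₃l h₃r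
  have hm2 : ((m : ℤ)) ^ 2 = (m : ℤ) * m := sq _
  have p₀₂ : |c₀ * c₂| ≤ (m : ℤ) ^ 2 := by
    rw [abs_mul, hm2]; exact mul_le_mul h₀ h₂ (abs_nonneg _) (by positivity)
  have p₀₃ : |c₀ * c₃| ≤ (m : ℤ) ^ 2 := by
    rw [abs_mul, hm2]; exact mul_le_mul h₀ h₃ (abs_nonneg _) (by positivity)
  have p₁₂ : |c₁ * c₂| ≤ (m : ℤ) ^ 2 := by
    rw [abs_mul, hm2]; exact mul_le_mul h₁ h₂ (abs_nonneg _) (by positivity)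
  have p₁₃ : |c₁ * c₃| ≤ (m : ℤ) ^ 2 := by
    rw [abs_mul, hm2]; exact mul_le_mul h₁ h₃ (abs_nonneg _) (by positivity)
  obtain ⟨l₀₂, r₀₂⟩ := abs_le.1 p₀₂
  obtain ⟨l₀₃, r₀₃⟩ := abs_le.1 p₀₃
  obtain ⟨l₁₂, r₁₂⟩ := abs_le.1 p₁₂
  obtain ⟨l₁₃, r₁₃⟩ := abs_le.1 p₁₃
  have m0 : (0 : ℤ) ≤ (m : ℤ) ^ 2 := sq_nonneg _
  have q₀ : |c₀ ^ 2 - 2 * c₁ ^ 2| ≤ 2 * (m : ℤ) ^ 2 :=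
    abs_le.2 ⟨by linarith [sq_nonneg c₀, sq_nonneg c₁], by linarith [sq_nonneg c₀, sq_nonneg c₁]⟩
  have q₁ : |c₀ * c₂ - 2 * c₀ * c₃ + 2 * c₁ * c₂ - 2 * c₁ * c₃| ≤ 7 * (m : ℤ) ^ 2 :=
    abs_le.2 ⟨by linarith, by linarith⟩
  have q₂ : |c₀ * c₂ - 2 * c₁ * c₃| ≤ 3 * (m : ℤ) ^ 2 := abs_le.2 ⟨by linarith, by linarith⟩
  have q₃ : |c₂ ^ 2 - 2 * c₃ ^ 2| ≤ 2 * (m : ℤ) ^ 2 :=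
    abs_le.2 ⟨by linarith [sq_nonneg c₂, sq_nonneg c₃], by linarith [sq_nonneg c₂, sq_nonneg c₃]⟩
  have r₀ := sq_le_sq' (abs_le.1 q₀).1 (abs_le.1 q₀).2
  have r₁ := sq_le_sq' (abs_le.1 q₁).1 (abs_le.1 q₁).2
  have r₂ := sq_le_sq' (abs_le.1 q₂).1 (abs_le.1 q₂).2
  have r₃ := sq_le_sq' (abs_le.1 q₃).1 (abs_le.1 q₃).2
  nlinarith [r₀, r₁, r₂, r₃]

/-- **Nonvanishing.** `P₀² + 2(P₁² + P₂² + P₃²) = 0` forces `c = 0`: `P₀ = c₀² - 2c₁² = 0` gives `c₁ = 0 = c₀`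
(`√2 ∉ ℚ`), and likewise `P₃ = c₂² - 2c₃² = 0` gives `c₂ = c₃ = 0`. [folklore] -/
theorem sqrtNegTwoPlusSqrtTwo_normForm_ne_zero (c₀ c₁ c₂ c₃ : ℤ) (hne : c₀ ≠ 0 ∨ c₁ ≠ 0 ∨ c₂ ≠ 0 ∨ c₃ ≠ 0) :
    (c₀ ^ 2 - 2 * c₁ ^ 2) ^ 2 + 2 * ((c₀ * c₂ - 2 * c₀ * c₃ + 2 * c₁ * c₂ - 2 * c₁ * c₃) ^ 2
      + (c₀ * c₂ - 2 * c₁ * c₃) ^ 2 + (c₂ ^ 2 - 2 * c₃ ^ 2) ^ 2) ≠ 0 := by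
  intro h
  have hP₀ : c₀ ^ 2 - 2 * c₁ ^ 2 = 0 := by nlinarith
  have hP₃ : c₂ ^ 2 - 2 * c₃ ^ 2 = 0 := by nlinarith
  have hc₁ : c₁ = 0 := by
    by_contra h1
    have e₁ := congrArg (Int.cast : ℤ → ℚ) hP₀
    push_cast at e₁
    exact rat_sq_ne_prime_mul_sq (by norm_num : Nat.Prime 2) (m := (c₁ : ℚ)) (by exact_mod_cast h1)
      (c₀ : ℚ) (by linear_combination e₁)
  have hc₃ : c₃ = 0 := by
    by_contra h3
    have e₃ := congrArg (Int.cast : ℤ → ℚ) hP₃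
    push_cast at e₃
    exact rat_sq_ne_prime_mul_sq (by norm_num : Nat.Prime 2) (m := (c₃ : ℚ)) (by exact_mod_cast h3)
      (c₂ : ℚ) (by linear_combination e₃)
  rw [hc₁] at hP₀
  rw [hc₃] at hP₃
  have hc₀ : c₀ = 0 := by nlinarith
  have hc₂ : c₂ = 0 := by nlinarith
  rcases hne with h | h | h | h <;> contradiction

end NormForm

end Summit.HodgeConjecture.HodgeConjecture.Ring2.WeilCoverageCM

end
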